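import Literature.NumberTheory.Sieve.ParityWave0
import Literature.NumberTheory.Sieve.LinearEquationsInPrimesTransference
import HarnessLib

/-!
# Green–Tao (2008): pseudorandom measures, the relative Szemerédi theorem, and the assembly of Theorem 1.1

Trunk T-SIEVE (`Literature/NumberTheory/Sieve`). This file decomposes the Green–Tao theorem
**parity.S14** (`Literature.NumberTheory.Sieve.exists_prime_arithmetic_progression`: the primes contain a `k`-term
arithmetic progression for every `k`; B. Green, T. Tao, *The primes contain arbitrarily long
arithmetic progressions*, Ann. of Math. 167 (2008), 481–547, Theorem 1.1) along the printed
proof, vendoring its three inputs as named facts and PROVING the assembly step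
("Proof of Theorem 1.1 assuming Proposition 9.1", pp. 523–524):

* §3 (pp. 488–492), real definitions for a family of weights `ν = (ν_N)`, `ν_N : ℤ/Nℤ → ℝ`
  (Green–Tao's `ν : ℤ_N → ℝ⁺` with "`o(1)` = a quantity tending to zero as the prime
  `N → ∞`", p. 488):
  `LinearFormsCondition m₀ t₀ L₀ ν` (Def. 3.1), `CorrelationCondition m₀ ν` (Def. 3.2),
  `IsPseudorandom k ν` (Def. 3.3: the `(k 2^{k-1}, 3k-4, k)`-linear forms condition and the
  `2^{k-1}`-correlation condition), with the sanity theorem `isPseudorandom_one`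
  ("`ν_const ≡ 1` is clearly `k`-pseudorandom for any `k`", p. 491);
* §9 (pp. 522–523): `eps k = ε_k = 1/(2^k (k+4)!)`, the `W`-tricked
  `modifiedVonMangoldt W n = Λ̃(n) = (φ(W)/W) log(Wn+1)` if `Wn+1` is prime and `0` otherwise
  (`W = ∏_{p ≤ w(N)} p = primorial (w N)`);
* named facts (`def … : Prop`, cited, to be discharged bottom-up in later sessions):
  `SzemerediExpectation` (Prop. 2.3, Szemerédi's theorem in expectation form — the input of
  §§4–8), `RelativeSzemeredi` (Thm. 3.5), `PseudorandomMajorant` (Prop. 9.1),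
  `ModifiedVonMangoldtSum` (the display on p. 523, `∑_{n ≤ N} Λ̃(n) = N(1 + o(1))` for `w`
  sufficiently slowly growing, in the windowed form in which it is used on p. 524);
* proved: `exists_int_common_difference` (no wrap-around: a progression `x, x+r, …, x+(k-1)r`
  in `ℤ/Nℤ` whose members have representatives in a window of length `< N/k` is a genuine
  progression of integers, p. 524), `exists_prime_ap_of_window` (from the modified primes
  `W nᵢ + 1` back to primes in arithmetic progression, p. 523), and the assembly
  `Literature.NumberTheory.Sieve.exists_prime_arithmetic_progression_of_greenTao`:
  `RelativeSzemeredi → PseudorandomMajorant → ModifiedVonMangoldtSum →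
   Literature.Parity.exists_prime_arithmetic_progression`.

The discharge `Literature.Parity.exists_prime_arithmetic_progression_holds` therefore reduces to the
three named facts; their own decomposition (Prop. 2.3 ⇒ Thm. 3.5 via §§4–8; Def. 9.3,
Lemma 9.4, Props. 9.5–9.10, §10 and the Appendix ⇒ Prop. 9.1; the prime number theorem in
arithmetic progressions / Siegel–Walfisz ⇒ the p. 523 display) is recorded in the session notes
and is NOT claimed here.

## Design choices

* Families. Green–Tao's measure `ν : ℤ_N → ℝ⁺` depends on the ambient prime `N` and every
  `o(1)`/`O(1)` refers to `N → ∞` (p. 488: "we will write `o(1)` for a quantity that tends to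
  zero as `N → ∞`"). We therefore take `ν : (N : ℕ) → ZMod N → ℝ` and render "`= 1 + o(1)`
  uniformly in `b`" as `∀ ε > 0, ∀ᶠ N in atTop, ∀ [Fact N.Prime], ∀ b, |… - 1| ≤ ε`, and
  "`= O(1)`" as "`≤ C` for all sufficiently large prime `N`" (equivalent to a bound for all prime
  `N`, the finitely many small `N` being absorbed into `C`); likewise (3.6) is asked for all
  sufficiently large prime `N` — equivalent for Theorem 3.5, whose conclusion is itself
  asymptotic in `N` (change `ν_N`, `τ_N` to `1` at the finitely many exceptional `N`).
* Def. 3.1 uses rational coefficients `L_{ij}` of height `≤ L₀` "interpreted as elements of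
  `ℤ_N` in the usual manner (assuming `N` is prime and larger than `L₀`)": we cast
  `(L i j : ℚ) : ZMod N` in the field `ZMod N` (`Fact N.Prime`); for `N > L₀` the denominator is
  invertible and the cast is the intended one; the finitely many primes `N ≤ L₀` are irrelevant
  to an `N → ∞` statement.
* Def. 3.2 asks `E(τ^q) = O_{m,q}(1)` "for all `1 ≤ q < ∞`"; we record it for all natural
  `q ≥ 1`, which is equivalent (on the probability space `ℤ_N`, `E(τ^q) ≤ E(τ^⌈q⌉)^{q/⌈q⌉}` by
  Hölder, `τ ≥ 0`).
* Nonnegativity `ν ≥ 0` ("`ν : ℤ_N → ℝ⁺`") is part of `IsPseudorandom`; the measure condition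
  (2.4) `E(ν) = 1 + o(1)` is the case `m = t = 1` of the linear forms condition (Remark after
  Def. 3.1) and is not repeated.
* Expectations `E(f | x ∈ A)` are Mathlib's `Finset.expect` (`𝔼 x, f x`).
* "`w(N)` tending to infinity sufficiently slowly" (p. 523; Prop. 9.5, Lemma 9.4: "if `w(N)` is
  sufficiently slowly growing in `N`") is rendered, in `PseudorandomMajorant` and in
  `ModifiedVonMangoldtSum` alike, as: there is a growth bound `G → ∞` such that every `w → ∞`
  with `w ≤ G` works (the diagonal reading; for the p. 523 display the paper adds that
  `w(N) ≪ log log N` suffices — a Siegel–Walfisz-strength remark which is quoted but not vendored).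
* `Λ̃` is not redefined: it is Green–Tao 2010's `Λ'_{1,W}` (`Literature.vonMangoldtW W 1`, already in
  the tree), abbreviated as `modifiedVonMangoldt W`.
* Nothing here restates the summit: `Literature.NumberTheory.Sieve.exists_prime_arithmetic_progression` is imported
  from `ParityWave0` and only *concluded*.

## References

* B. Green, T. Tao, *The primes contain arbitrarily long arithmetic progressions*, Ann. of
  Math. (2) 167 (2008), 481–547, doi:10.4007/annals.2008.167.481: Thm. 1.1 (p. 482), Prop. 2.3
  (p. 485), Defs. 3.1–3.3 and Lemma 3.4 (pp. 489–491), Thm. 3.5 (p. 492), §9 pp. 522–524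
  (the `W`-trick, `Λ̃`, Prop. 9.1, proof of Thm. 1.1 assuming Prop. 9.1).
  [cite: GreenTaoAnnals2008]
* E. Szemerédi, *On sets of integers containing no `k` elements in arithmetic progression*,
  Acta Arith. 27 (1975), 199–245 (Prop. 2.3 via Varnavides; GT refs. [38], [43]).
-/

noncomputable section

open Filter Finset Topology
open scoped BigOperators

namespace Literature.NumberTheory.Sieve.GreenTao2008

/-! ### §3. Pseudorandom measures (families indexed by the prime `N`) -/

/-- **Green–Tao 2008, Definition 3.1 (linear forms condition).** A family `ν = (ν_N)`,
`ν_N : ℤ/Nℤ → ℝ`, satisfies the `(m₀, t₀, L₀)`-linear forms condition if for all `m ≤ m₀`,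
`t ≤ t₀`, all rational matrices `(L_{ij})_{i ≤ m, j ≤ t}` with numerators and denominators at
most `L₀` in absolute value whose rows are nonzero and pairwise not rational multiples of each
other, `E(ν(ψ₁(x)) ⋯ ν(ψ_m(x)) | x ∈ ℤ_N^t) = 1 + o_{L₀,m₀,t₀}(1)` for the forms
`ψ_i(x) = ∑_j L_{ij} x_j + b_i`, the decay being uniform in `b₁, …, b_m ∈ ℤ_N`; here `N → ∞`
through primes and `L_{ij}` is read in the field `ℤ/Nℤ`.
[cite: GreenTaoAnnals2008, Definition 3.1] -/
def LinearFormsCondition (m₀ t₀ L₀ : ℕ) (ν : (N : ℕ) → ZMod N → ℝ) : Prop :=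
  ∀ (m t : ℕ), m ≤ m₀ → t ≤ t₀ → ∀ L : Fin m → Fin t → ℚ,
    (∀ i j, (L i j).num.natAbs ≤ L₀ ∧ (L i j).den ≤ L₀) →
    (∀ i, L i ≠ 0) → (∀ i i', i ≠ i' → ∀ c : ℚ, L i ≠ c • L i') →
    ∀ ε : ℝ, 0 < ε → ∀ᶠ N : ℕ in atTop, ∀ [Fact N.Prime], ∀ b : Fin m → ZMod N,
      |𝔼 x : Fin t → ZMod N, ∏ i, ν N (∑ j, ((L i j : ℚ) : ZMod N) * x j + b i) - 1| ≤ ε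

/-- **Green–Tao 2008, Definition 3.2 (correlation condition).** A family `ν = (ν_N)` satisfies
the `m₀`-correlation condition if for every `1 < m ≤ m₀` there is a weight
`τ = τ_m : ℤ_N → ℝ⁺` with bounded moments `E(τ^q) = O_{m,q}(1)` for every `1 ≤ q < ∞`
(recorded for natural `q`, an equivalent formulation by Hölder) such that
`E(ν(x + h₁) ⋯ ν(x + h_m) | x ∈ ℤ_N) ≤ ∑_{1 ≤ i < j ≤ m} τ(h_i - h_j)` for all
`h₁, …, h_m ∈ ℤ_N` (for all sufficiently large prime `N`).
[cite: GreenTaoAnnals2008, Definition 3.2] -/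
def CorrelationCondition (m₀ : ℕ) (ν : (N : ℕ) → ZMod N → ℝ) : Prop :=
  ∀ m : ℕ, 1 < m → m ≤ m₀ → ∃ τ : (N : ℕ) → ZMod N → ℝ,
    (∀ N h, 0 ≤ τ N h) ∧
    (∀ q : ℕ, 1 ≤ q → ∃ C : ℝ, ∀ᶠ N : ℕ in atTop, ∀ [Fact N.Prime],
      𝔼 h : ZMod N, τ N h ^ q ≤ C) ∧
    ∀ᶠ N : ℕ in atTop, ∀ [Fact N.Prime], ∀ h : Fin m → ZMod N,
      𝔼 x : ZMod N, ∏ i, ν N (x + h i) ≤ ∑ i : Fin m, ∑ j : Fin m with i < j, τ N (h i - h j)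

/-- **Green–Tao 2008, Definition 3.3 (`k`-pseudorandom measure).** `ν = (ν_N)`,
`ν_N : ℤ_N → ℝ⁺` (nonnegative), is `k`-pseudorandom if it satisfies the
`(k·2^{k-1}, 3k-4, k)`-linear forms condition and the `2^{k-1}`-correlation condition
(intended for `k ≥ 3`, the standing assumption of §§4–9). [cite: GreenTaoAnnals2008, Definition 3.3] -/
def IsPseudorandom (k : ℕ) (ν : (N : ℕ) → ZMod N → ℝ) : Prop :=
  (∀ N x, 0 ≤ ν N x) ∧ LinearFormsCondition (k * 2 ^ (k - 1)) (3 * k - 4) k ν ∧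
    CorrelationCondition (2 ^ (k - 1)) ν

/-! ### §9. The `W`-trick and the modified von Mangoldt function -/

/-- `ε_k = 1 / (2^k (k+4)!)` (Prop. 9.1 / Def. 9.3; its purpose is to avoid wrap-around in
`ℤ_N`, `ε_k < 1/k`). [cite: GreenTaoAnnals2008, Proposition 9.1] -/
def eps (k : ℕ) : ℝ :=
  1 / (2 ^ k * (Nat.factorial (k + 4) : ℝ))

/-- The modified (`W`-tricked) von Mangoldt function
`Λ̃(n) = (φ(W)/W) log(W n + 1)` if `W n + 1` is prime, `0` otherwise, where `W = ∏_{p ≤ w} p`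
(here an explicit parameter; in the paper `W = W(N)` with `w = w(N) → ∞` slowly). Prime powers
are deliberately discarded. This is *exactly* the case `b = 1` of Green–Tao 2010's
`Λ'_{b,W}(n) = (φ(W)/W) Λ'(W n + b)` already in the tree (`Literature.NumberTheory.Sieve.vonMangoldtW`, file
`LinearEquationsInPrimesTransference`), so it is an abbreviation of it, not a new definition;
`modifiedVonMangoldt_eq` is the printed formula. [cite: GreenTaoAnnals2008, §9 (p. 523)] -/
abbrev modifiedVonMangoldt (W n : ℕ) : ℝ :=
  Literature.NumberTheory.Sieve.vonMangoldtW W 1 n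

/-- The printed formula for `Λ̃`. [cite: GreenTaoAnnals2008, §9 (p. 523)] -/
theorem modifiedVonMangoldt_eq (W n : ℕ) :
    modifiedVonMangoldt W n =
      if (W * n + 1).Prime then (Nat.totient W : ℝ) / W * Real.log (W * n + 1) else 0 := by
  unfold modifiedVonMangoldt Literature.NumberTheory.Sieve.vonMangoldtW Literature.NumberTheory.Sieve.vonMangoldtPrime
  split_ifs with h
  · push_cast; rfl
  · exact mul_zero _

/-! ### Named facts -/

/-- **Green–Tao 2008, Proposition 2.3 (Szemerédi's theorem, expectation form; Szemerédi 1975 +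
Varnavides, direct proof in Tao, Electron. J. Combin. 13 (2006)).** For `0 < δ ≤ 1` and `k ≥ 1`
there is `c(k, δ) > 0` such that for every `f : ℤ_N → ℝ` with `0 ≤ f ≤ 1` and `E(f) ≥ δ`,
`E(f(x) f(x+r) ⋯ f(x+(k-1)r) | x, r ∈ ℤ_N) ≥ c(k, δ) - o_{k,δ}(1)` (`N → ∞` through all
integers, uniformly in `f`). Named fact (Szemerédi's theorem is not in Mathlib beyond `k = 3`).
[cite: GreenTaoAnnals2008, Proposition 2.3] -/
def SzemerediExpectation : Prop :=
  ∀ k : ℕ, 1 ≤ k → ∀ δ : ℝ, 0 < δ → δ ≤ 1 → ∃ c : ℝ, 0 < c ∧ ∀ η : ℝ, 0 < η →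
    ∀ᶠ N : ℕ in atTop, ∀ [NeZero N], ∀ f : ZMod N → ℝ,
      (∀ x, 0 ≤ f x) → (∀ x, f x ≤ 1) → δ ≤ 𝔼 x, f x →
        c - η ≤ 𝔼 x : ZMod N, 𝔼 r : ZMod N, ∏ i : Fin k, f (x + (i : ℕ) * r)

/-- **Green–Tao 2008, Theorem 3.5 (Szemerédi's theorem relative to a pseudorandom measure).**
Let `k ≥ 3` and `0 < δ ≤ 1`. There is `c(k, δ) > 0` (the constant of Prop. 2.3) such that for
every `k`-pseudorandom family `ν` and every `f : ℤ_N → ℝ` with `0 ≤ f ≤ ν_N` and `E(f) ≥ δ`,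
`E(f(x) f(x+r) ⋯ f(x+(k-1)r) | x, r ∈ ℤ_N) ≥ c(k, δ) - o_{k,δ}(1)`, the decay depending on
`k, δ` and the decay rates in the pseudorandomness conditions (i.e. on `ν`) but not on `f`.
Proved in §§4–8 from Prop. 2.3. Named fact. [cite: GreenTaoAnnals2008, Theorem 3.5] -/
def RelativeSzemeredi : Prop :=
  ∀ k : ℕ, 3 ≤ k → ∀ δ : ℝ, 0 < δ → δ ≤ 1 → ∃ c : ℝ, 0 < c ∧
    ∀ ν : (N : ℕ) → ZMod N → ℝ, IsPseudorandom k ν → ∀ η : ℝ, 0 < η →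
      ∀ᶠ N : ℕ in atTop, ∀ [Fact N.Prime], ∀ f : ZMod N → ℝ,
        (∀ x, 0 ≤ f x) → (∀ x, f x ≤ ν N x) → δ ≤ 𝔼 x, f x →
          c - η ≤ 𝔼 x : ZMod N, 𝔼 r : ZMod N, ∏ i : Fin k, f (x + (i : ℕ) * r)

/-- **Green–Tao 2008, Proposition 9.1 (a pseudorandom measure which majorises the modified
primes).** Let `k ≥ 3`, `ε_k = 1/(2^k (k+4)!)`, and let `w = w(N) → ∞` sufficiently slowly,
`W = ∏_{p ≤ w(N)} p`. Then for all sufficiently large primes `N` there is a `k`-pseudorandom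
measure `ν : ℤ_N → ℝ⁺` with `ν(n) ≥ k⁻¹ 2^{-k-5} Λ̃(n)` for all `ε_k N ≤ n ≤ 2 ε_k N`
(integers `n < N` identified with `ℤ_N`). "Sufficiently slowly" is rendered as a growth bound
`G → ∞` below which every `w → ∞` is admissible; pseudorandomness of the family `(ν_N)` carries
the `o(1)` decay. Proved in §§9–10 and the Appendix (Goldston–Yıldırım). Named fact.
[cite: GreenTaoAnnals2008, Proposition 9.1] -/
def PseudorandomMajorant : Prop :=
  ∀ k : ℕ, 3 ≤ k → ∃ G : ℕ → ℕ, Tendsto G atTop atTop ∧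
    ∀ w : ℕ → ℕ, Tendsto w atTop atTop → (∀ N, w N ≤ G N) →
      ∃ ν : (N : ℕ) → ZMod N → ℝ, IsPseudorandom k ν ∧
        ∀ᶠ N : ℕ in atTop, N.Prime → ∀ n : ℕ, eps k * N ≤ n → (n : ℝ) ≤ 2 * eps k * N →
          (k : ℝ)⁻¹ * 2⁻¹ ^ (k + 5) * modifiedVonMangoldt (primorial (w N)) n ≤ ν N n

/-- **Green–Tao 2008, p. 523 (the Dirichlet-type input) as used on p. 524.** "Observe that if
`w(N)` is sufficiently slowly growing (`w(N) ≪ log log N` will suffice here) then by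
Dirichlet's theorem concerning the distribution of the primes in arithmetic progressions such
as `{n : n ≡ 1 (mod W)}` we have `∑_{n ≤ N} Λ̃(n) = N (1 + o(1))`" (`W = ∏_{p ≤ w(N)} p`); on
p. 524 this is used ("From Dirichlet's theorem we observe that …") in the windowed form
`∑_{ε_k N ≤ n ≤ 2 ε_k N} Λ̃(n) = ε_k N (1 + o(1))`. Recorded for windows `[κ₁ N, κ₂ N]`,
`0 ≤ κ₁ < κ₂ ≤ 1` (`κ₁ = 0, κ₂ = 1` is the display itself, as `Λ̃(0) = 0`), and with
"`w(N) → ∞` sufficiently slowly" rendered exactly as in `PseudorandomMajorant`: there is a growth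
bound `G → ∞` below which every `w → ∞` is admissible (this is what the prime number theorem in
the progressions `1 mod W` for each fixed `W` gives by diagonalisation; the printed parenthetical
sufficient condition `w(N) ≪ log log N` — Siegel–Walfisz range — is stronger and is not claimed
here). Named fact. [cite: GreenTaoAnnals2008, §9 p. 523 (display before Proposition 9.1) and p. 524] -/
def ModifiedVonMangoldtSum : Prop :=
  ∃ G : ℕ → ℕ, Tendsto G atTop atTop ∧
    ∀ w : ℕ → ℕ, Tendsto w atTop atTop → (∀ N, w N ≤ G N) →
      ∀ κ₁ κ₂ : ℝ, 0 ≤ κ₁ → κ₁ < κ₂ → κ₂ ≤ 1 →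
        Tendsto (fun N : ℕ => (N : ℝ)⁻¹ *
          ∑ n ∈ Icc ⌈κ₁ * N⌉₊ ⌊κ₂ * N⌋₊, modifiedVonMangoldt (primorial (w N)) n)
          atTop (𝓝 (κ₂ - κ₁))

/-! ### API: the constant measure, unfolding lemmas -/

/-- `ε_k > 0`. [cite: GreenTaoAnnals2008, Proposition 9.1] -/
theorem eps_pos (k : ℕ) : 0 < eps k := by
  unfold eps
  positivity

/-- `k ε_k < 1`, indeed `2 k ε_k ≤ 1`: the window `[ε_k N, 2ε_k N]` has length `ε_k N < N/k`,
which is what rules out wrap-around (p. 524, "since `ε_k < 1/k`").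
[cite: GreenTaoAnnals2008, p. 524] -/
theorem two_mul_mul_eps_le_one (k : ℕ) : 2 * k * eps k ≤ 1 := by
  unfold eps
  have h2 : (1 : ℝ) ≤ 2 ^ k := one_le_pow₀ (by norm_num)
  have hk : (2 * k : ℝ) ≤ (Nat.factorial (k + 4) : ℝ) := by
    have h1 : k + 3 ≤ Nat.factorial (k + 3) := Nat.self_le_factorial _
    have h2 : Nat.factorial (k + 4) = (k + 4) * Nat.factorial (k + 3) := Nat.factorial_succ _
    have : (2 * k : ℕ) ≤ Nat.factorial (k + 4) := by rw [h2]; nlinarith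
    exact_mod_cast this
  have hf : (0 : ℝ) < (Nat.factorial (k + 4) : ℝ) := by positivity
  rw [mul_one_div, div_le_one (by positivity)]
  calc (2 * k : ℝ) ≤ (Nat.factorial (k + 4) : ℝ) := hk
    _ = 1 * (Nat.factorial (k + 4) : ℝ) := (one_mul _).symm
    _ ≤ 2 ^ k * (Nat.factorial (k + 4) : ℝ) := by gcongr

/-- `ε_k ≤ 1/24` (`2^k ≥ 1`, `(k+4)! ≥ 4!`). [cite: GreenTaoAnnals2008, Definition 9.3] -/
theorem eps_le (k : ℕ) : eps k ≤ 1 / 24 := by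
  unfold eps
  have h2 : (1 : ℝ) ≤ 2 ^ k := one_le_pow₀ (by norm_num)
  have hf : (24 : ℝ) ≤ (Nat.factorial (k + 4) : ℝ) := by
    have : Nat.factorial 4 ≤ Nat.factorial (k + 4) := Nat.factorial_le (by omega)
    exact_mod_cast this
  gcongr
  calc (24 : ℝ) = 1 * 24 := by norm_num
    _ ≤ 2 ^ k * (Nat.factorial (k + 4) : ℝ) := by gcongr

/-- `2 ε_k < 1`, so the window `[ε_k N, 2 ε_k N]` lies inside `[0, N)`.
[cite: GreenTaoAnnals2008, Definition 9.3] -/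
theorem two_mul_eps_lt_one (k : ℕ) : 2 * eps k < 1 := by
  have := eps_le k
  linarith

/-- `0 ≤ Λ̃(n)`. [cite: GreenTaoAnnals2008, §9 (p. 523)] -/
theorem modifiedVonMangoldt_nonneg (W n : ℕ) : 0 ≤ modifiedVonMangoldt W n := by
  rw [modifiedVonMangoldt_eq]
  split_ifs with h
  · refine mul_nonneg (by positivity) (Real.log_nonneg ?_)
    exact_mod_cast Nat.succ_le_succ (Nat.zero_le _)
  · exact le_rfl

/-- `Λ̃(n) ≤ log(W n + 1)` (`φ(W) ≤ W`). [cite: GreenTaoAnnals2008, §9 (p. 523)] -/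
theorem modifiedVonMangoldt_le_log (W n : ℕ) :
    modifiedVonMangoldt W n ≤ Real.log (W * n + 1) := by
  have hlog : 0 ≤ Real.log (W * n + 1) :=
    Real.log_nonneg (by exact_mod_cast Nat.succ_le_succ (Nat.zero_le _))
  rw [modifiedVonMangoldt_eq]
  split_ifs with h
  · have hφ : (Nat.totient W : ℝ) / W ≤ 1 := by
      rcases Nat.eq_zero_or_pos W with hW | hW
      · simp [hW]
      · rw [div_le_one (by exact_mod_cast hW)]
        exact_mod_cast Nat.totient_le W
    calc (Nat.totient W : ℝ) / W * Real.log (W * n + 1) ≤ 1 * Real.log (W * n + 1) := by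
          gcongr
      _ = Real.log (W * n + 1) := one_mul _
  · exact hlog

/-- If `Λ̃(n) ≠ 0` then `W n + 1` is prime. [cite: GreenTaoAnnals2008, §9 (p. 523)] -/
theorem prime_of_modifiedVonMangoldt_ne_zero {W n : ℕ} (h : modifiedVonMangoldt W n ≠ 0) :
    (W * n + 1).Prime := by
  rw [modifiedVonMangoldt_eq] at h
  by_contra hp
  exact h (if_neg hp)

/-- The constant family `ν_const ≡ 1` is `k`-pseudorandom for every `k` ("clearly", p. 491):
all the expectations in Defs. 3.1–3.2 are exactly `1`, with `τ ≡ 1`.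
[cite: GreenTaoAnnals2008, §3 (p. 491, before Lemma 3.4)] -/
theorem isPseudorandom_one (k : ℕ) : IsPseudorandom k (fun _ _ => 1) := by
  refine ⟨fun _ _ => zero_le_one, ?_, ?_⟩
  · intro m t _ _ L _ _ _ ε hε
    filter_upwards with N
    intro _ b
    simp [Finset.prod_const_one, hε.le]
  · intro m hm _
    refine ⟨fun _ _ => 1, fun _ _ => zero_le_one, fun q _ => ⟨1, ?_⟩, ?_⟩
    · filter_upwards with N
      intro _
      simp
    · filter_upwards with N
      intro _ h
      have hL : 𝔼 x : ZMod N, ∏ i : Fin m, (fun (_ : ℕ) (_ : ZMod N) => (1 : ℝ)) N (x + h i) = 1 := by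
        simp
      rw [hL]
      -- `1 ≤ ∑_i #{j | i < j}`: the pair `(0, 1)` is present since `m > 1`
      calc (1 : ℝ) = ∑ j ∈ ({⟨1, hm⟩} : Finset (Fin m)), (1 : ℝ) := by simp
        _ ≤ ∑ j : Fin m with (⟨0, by omega⟩ : Fin m) < j, (1 : ℝ) := by
          refine Finset.sum_le_sum_of_subset_of_nonneg (fun j hj => ?_) fun _ _ _ => zero_le_one
          rw [Finset.mem_singleton] at hj
          subst hj
          simp [Fin.lt_def]
        _ ≤ ∑ i : Fin m, ∑ j : Fin m with i < j, (1 : ℝ) :=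
          Finset.single_le_sum (f := fun i : Fin m => ∑ j : Fin m with i < j, (1 : ℝ))
            (fun i _ => Finset.sum_nonneg fun _ _ => zero_le_one) (Finset.mem_univ _)

/-! ### No wrap-around and the passage back to primes (p. 524) -/

/-- **No wrap-around** (p. 524: "every progression counted … is not just a progression in `ℤ_N`,
but a genuine arithmetic progression of integers since `ε_k < 1/k`"). If `x, x + r, …, x + (k-1) r`
(`k ≥ 2`, `r ≠ 0` in `ℤ/Nℤ`) have representatives `n_0, …, n_{k-1} ∈ [L, L + B]` with
`k B < N`, then `n_i = n_0 + i d` for a nonzero integer `d` (namely `d = n_1 - n_0`): the integer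
`n_i - n_0 - i d` is divisible by `N` and at most `B + (k-1) B < N` in absolute value.
[cite: GreenTaoAnnals2008, p. 524 (proof of Theorem 1.1)] -/
theorem exists_int_common_difference {N k B : ℕ} (hk : 2 ≤ k) (hkB : k * B < N)
    (x r : ZMod N) (hr : r ≠ 0) (n : Fin k → ℕ) (L : ℕ)
    (hn : ∀ i, ((n i : ℕ) : ZMod N) = x + (i : ℕ) * r)
    (hL : ∀ i, L ≤ n i) (hB : ∀ i, n i ≤ L + B) :
    ∃ d : ℤ, d ≠ 0 ∧ ∀ i : Fin k, (n i : ℤ) = n ⟨0, by omega⟩ + (i : ℕ) * d := by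
  set i₀ : Fin k := ⟨0, by omega⟩
  set i₁ : Fin k := ⟨1, by omega⟩
  refine ⟨(n i₁ : ℤ) - n i₀, ?_, fun i => ?_⟩
  · intro hd
    have h1 : n i₁ = n i₀ := by exact_mod_cast (sub_eq_zero.mp hd)
    have h2 := hn i₁
    rw [h1, hn i₀] at h2
    have : r = 0 := by simpa [i₀, i₁] using h2
    exact hr this
  · have hdiv : (N : ℤ) ∣ ((n i : ℤ) - n i₀ - (i : ℕ) * ((n i₁ : ℤ) - n i₀)) := by
      rw [← ZMod.intCast_zmod_eq_zero_iff_dvd]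
      push_cast
      rw [hn i, hn i₀, hn i₁]
      simp only [i₀, i₁, Nat.cast_zero, Nat.cast_one, zero_mul, add_zero, one_mul]
      ring
    have hik : (i : ℤ) + 1 ≤ k := by
      have := i.isLt
      omega
    have hB0 : (0 : ℤ) ≤ B := by positivity
    have ha : |(n i : ℤ) - n i₀| ≤ B := by
      have h₁ := hL i; have h₂ := hB i; have h₃ := hL i₀; have h₄ := hB i₀
      rw [abs_le]
      constructor <;> omega
    have hb : |(n i₁ : ℤ) - n i₀| ≤ B := by
      have h₁ := hL i₁; have h₂ := hB i₁; have h₃ := hL i₀; have h₄ := hB i₀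
      rw [abs_le]
      constructor <;> omega
    have habs : |(n i : ℤ) - n i₀ - (i : ℕ) * ((n i₁ : ℤ) - n i₀)| < N := by
      have hkB' : (k : ℤ) * B < N := by exact_mod_cast hkB
      have hi0 : (0 : ℤ) ≤ (i : ℕ) := by positivity
      calc |(n i : ℤ) - n i₀ - (i : ℕ) * ((n i₁ : ℤ) - n i₀)|
          ≤ |(n i : ℤ) - n i₀| + |((i : ℕ) : ℤ) * ((n i₁ : ℤ) - n i₀)| := abs_sub _ _
        _ = |(n i : ℤ) - n i₀| + (i : ℕ) * |(n i₁ : ℤ) - n i₀| := by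
          rw [abs_mul, abs_of_nonneg hi0]
        _ ≤ B + (i : ℕ) * B := by gcongr
        _ ≤ B + (k - 1) * B := by
          gcongr
          · linarith
        _ = k * B := by ring
        _ < N := hkB'
    have h0 := Int.eq_zero_of_abs_lt_dvd hdiv habs
    linear_combination h0

/-- From modified primes to primes, positive step: if `n_i = n_0 + i d` (`d > 0`) and all
`W n_i + 1` are prime (`W ≥ 1`), then `a + i s` is prime for `i < k` with `a = W n_0 + 1`,
`s = W d > 0` (p. 523: "in order to obtain arithmetic progressions in the primes, it suffices
to do so in the modified primes `{n : W n + 1 is prime}`").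
[cite: GreenTaoAnnals2008, §9 p. 523] -/
theorem exists_prime_ap_of_pos_step {k W : ℕ} (n : Fin k → ℕ) (d : ℤ) (hd : 0 < d) (i₀ : Fin k)
    (hn : ∀ i : Fin k, (n i : ℤ) = n i₀ + (i : ℕ) * d) (hW : 0 < W)
    (hp : ∀ i, (W * n i + 1).Prime) : ∃ a s : ℕ, 0 < s ∧ ∀ i < k, (a + i * s).Prime := by
  refine ⟨W * n i₀ + 1, W * d.toNat, Nat.mul_pos hW (by omega), fun i hi => ?_⟩
  have hcast : ((W * n i₀ + 1 + i * (W * d.toNat) : ℕ) : ℤ) = ((W * n ⟨i, hi⟩ + 1 : ℕ) : ℤ) := by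
    push_cast
    rw [hn ⟨i, hi⟩, Int.toNat_of_nonneg hd.le]
    ring
  rw [Int.natCast_inj.mp hcast]
  exact hp ⟨i, hi⟩

/-- From modified primes to primes, any nonzero integer step: reverse the progression when
`d < 0` (`n_{k-1-i} = n_{k-1} + i (-d)`). (The base index `i₀` is necessarily the index `0`,
as `i₀ d = 0`.) [cite: GreenTaoAnnals2008, §9 pp. 523–524] -/
theorem exists_prime_ap_of_window {k W : ℕ} (n : Fin k → ℕ) (d : ℤ) (hd : d ≠ 0) (i₀ : Fin k)
    (hn : ∀ i : Fin k, (n i : ℤ) = n i₀ + (i : ℕ) * d) (hW : 0 < W)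
    (hp : ∀ i, (W * n i + 1).Prime) : ∃ a s : ℕ, 0 < s ∧ ∀ i < k, (a + i * s).Prime := by
  rcases lt_or_gt_of_ne hd with hneg | hpos
  · have hk : 0 < k := i₀.pos
    refine exists_prime_ap_of_pos_step (fun i => n (Fin.rev i)) (-d) (neg_pos.mpr hneg) ⟨0, hk⟩
      (fun i => ?_) hW fun i => hp _
    have hi : (i : ℕ) + 1 ≤ k := i.isLt
    have h1 := hn (Fin.rev i)
    have h2 := hn (Fin.rev ⟨0, hk⟩)
    simp only [Fin.val_rev] at h1 h2 ⊢
    rw [h1, h2]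
    push_cast [Nat.cast_sub hi, Nat.cast_sub (show 0 + 1 ≤ k from hk)]
    ring
  · exact exists_prime_ap_of_pos_step n d hpos i₀ hn hW hp

/-! ### Small analytic lemmas for the choice `w(N) = min(G(N), G'(N), ⌊log_4 log N⌋)` -/

/-- `1 < log x` for `x ≥ 3` (`e < 3`). [folklore] -/
theorem one_lt_log_of_three_le {x : ℝ} (hx : 3 ≤ x) : 1 < Real.log x :=
  (Real.lt_log_iff_exp_lt (by linarith)).2 (by linarith [Real.exp_one_lt_d9])

/-- `1 ≤ log 4` (`e ≤ 4`). [folklore] -/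
theorem one_le_log_four : (1 : ℝ) ≤ Real.log 4 :=
  ((Real.lt_log_iff_exp_lt (by norm_num)).2 (by linarith [Real.exp_one_lt_d9])).le

/-- With `w ≤ ⌊log_4 log N⌋` one has `W = ∏_{p ≤ w} p ≤ 4^w ≤ log N` (Chebyshev's
`primorial w ≤ 4^w`, Mathlib `primorial_le_four_pow`); this is the (very generous) instance of
"`w(N)` sufficiently slowly growing" used in the assembly. [folklore] -/
theorem primorial_le_log {N w : ℕ} (hN : 3 ≤ N) (hw : w ≤ ⌊Real.logb 4 (Real.log N)⌋₊) :
    (primorial w : ℝ) ≤ Real.log N := by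
  have hlog1 : 1 < Real.log N := one_lt_log_of_three_le (by exact_mod_cast hN)
  calc (primorial w : ℝ) ≤ ((4 ^ w : ℕ) : ℝ) := by exact_mod_cast primorial_le_four_pow w
    _ = (4 : ℝ) ^ ((w : ℕ) : ℝ) := by rw [Real.rpow_natCast]; push_cast; rfl
    _ ≤ (4 : ℝ) ^ ((⌊Real.logb 4 (Real.log N)⌋₊ : ℕ) : ℝ) :=
        Real.rpow_le_rpow_of_exponent_le (by norm_num) (by exact_mod_cast hw)
    _ ≤ (4 : ℝ) ^ Real.logb 4 (Real.log N) :=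
        Real.rpow_le_rpow_of_exponent_le (by norm_num)
          (Nat.floor_le (Real.logb_nonneg (by norm_num) hlog1.le))
    _ = Real.log N := Real.rpow_logb (by norm_num) (by norm_num) (by linarith)

end Literature.NumberTheory.Sieve.GreenTao2008

/-! ### Assembly: Theorem 1.1 from Theorem 3.5, Proposition 9.1 and the p. 523 display -/

namespace Literature.NumberTheory.Sieve

open GreenTao2008

/-- **Green–Tao 2008, "Proof of Theorem 1.1 assuming Proposition 9.1" (pp. 523–524), with
Theorem 3.5 and the Dirichlet-type input of p. 523 as the other two named hypotheses.**
For `k ≥ 3` (smaller `k`: the progression `2, 3`): choose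
`w(N) = min(G(N), G'(N), ⌊log_4 log N⌋)` (below the growth bounds of Prop. 9.1 and of the p. 523
display, and small enough that `W ≤ 4^w ≤ log N`), let `ν` be the `k`-pseudorandom majorant and
`f(n) = k⁻¹ 2^{-k-5} Λ̃(n) 1_{[ε_k N, 2ε_k N]}(n)` on `ℤ_N`; then `0 ≤ f ≤ ν`,
`E(f) = k⁻¹2^{-k-5} N⁻¹ ∑_{ε_k N ≤ n ≤ 2ε_k N} Λ̃(n) ≥ δ := k⁻¹ 2^{-k-6} ε_k` for large `N`, so
Theorem 3.5 gives `E(f(x) ⋯ f(x + (k-1) r) | x, r) ≥ c(k, δ)/2` for all large primes `N`; the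
terms with `r = 0` contribute at most `N⁻¹ (2 k⁻¹2^{-k-5} log N)^k = o(1)` (here
`f ≤ k⁻¹2^{-k-5} log(WN + 1) ≤ 2 k⁻¹ 2^{-k-5} log N` as `W ≤ log N`), so some `x` and `r ≠ 0`
have all `f(x + i r) ≠ 0`: the representatives `n_i ∈ [ε_k N, 2ε_k N]` satisfy `W n_i + 1`
prime, and since `k ε_k < 1` they form a genuine integer progression `n_i = n_0 + i d`, `d ≠ 0`
(`exists_int_common_difference`), whence primes `W n_0 + 1 + i W d` (or the reversed
progression if `d < 0`). [cite: GreenTaoAnnals2008, Theorem 1.1 and its proof pp. 523–524] -/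
theorem exists_prime_arithmetic_progression_of_greenTao (h₂ : RelativeSzemeredi)
    (h₃ : PseudorandomMajorant) (h₄ : ModifiedVonMangoldtSum) :
    exists_prime_arithmetic_progression := by
  intro k
  -- `k ≤ 2`: the progression `2, 3`
  by_cases hk : k < 3
  · refine ⟨2, 1, one_pos, fun i hi => ?_⟩
    have hi1 : i ≤ 1 := by omega
    interval_cases i <;> norm_num
  push Not at hk
  -- constants
  set ε : ℝ := eps k with hε_def
  have hε : 0 < ε := eps_pos k
  have h2ε : 2 * ε < 1 := two_mul_eps_lt_one k
  have hkε : 2 * k * ε ≤ 1 := two_mul_mul_eps_le_one k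
  set c₀ : ℝ := (k : ℝ)⁻¹ * 2⁻¹ ^ (k + 5) with hc₀_def
  have hc₀ : 0 < c₀ := by positivity
  have hc₀1 : c₀ ≤ 1 := by
    have h1 : (k : ℝ)⁻¹ ≤ 1 := inv_le_one_of_one_le₀ (by exact_mod_cast (show 1 ≤ k by omega))
    have h2 : (2⁻¹ : ℝ) ^ (k + 5) ≤ 1 := pow_le_one₀ (by norm_num) (by norm_num)
    exact mul_le_one₀ h1 (by positivity) h2
  -- Proposition 9.1 and the p. 523 display: growth bounds `G`, `G'`;
  -- choose `w = min(G, G', ⌊log_4 log N⌋)`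
  obtain ⟨G, hG, hG'⟩ := h₃ k hk
  obtain ⟨G₄, hG₄, hG₄'⟩ := h₄
  set w : ℕ → ℕ := fun N => min (min (G N) (G₄ N)) ⌊Real.logb 4 (Real.log N)⌋₊ with hw_def
  have hfl : Tendsto (fun N : ℕ => ⌊Real.logb 4 (Real.log N)⌋₊) atTop atTop :=
    tendsto_nat_floor_atTop.comp ((Real.tendsto_logb_atTop (by norm_num)).comp
      (Real.tendsto_log_atTop.comp tendsto_natCast_atTop_atTop))
  have hmin : ∀ u v : ℕ → ℕ, Tendsto u atTop atTop → Tendsto v atTop atTop →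
      Tendsto (fun N => min (u N) (v N)) atTop atTop := by
    intro u v hu hv
    rw [Filter.tendsto_atTop_atTop]
    intro b
    obtain ⟨i₁, hi₁⟩ := Filter.tendsto_atTop_atTop.1 hu b
    obtain ⟨i₂, hi₂⟩ := Filter.tendsto_atTop_atTop.1 hv b
    exact ⟨max i₁ i₂, fun a ha =>
      le_min (hi₁ a (le_of_max_le_left ha)) (hi₂ a (le_of_max_le_right ha))⟩
  have hw : Tendsto w atTop atTop := hmin _ _ (hmin _ _ hG hG₄) hfl
  have hwG : ∀ N, w N ≤ G N := fun N => (min_le_left _ _).trans (min_le_left _ _)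
  have hwG₄ : ∀ N, w N ≤ G₄ N := fun N => (min_le_left _ _).trans (min_le_right _ _)
  have hwlog : ∀ N, w N ≤ ⌊Real.logb 4 (Real.log N)⌋₊ := fun N => min_le_right _ _
  obtain ⟨ν, hν, hmaj⟩ := hG' w hw hwG
  have h4 := hG₄' w hw hwG₄ ε (2 * ε) hε.le (by linarith) h2ε.le
  have hE3 : ∀ᶠ N : ℕ in atTop, ε / 2 ≤ (N : ℝ)⁻¹ *
      ∑ n ∈ Icc ⌈ε * N⌉₊ ⌊2 * ε * N⌋₊, modifiedVonMangoldt (primorial (w N)) n :=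
    h4.eventually_const_le (by linarith)
  -- Theorem 3.5 with `δ = c₀ ε / 2`
  have hδ1 : c₀ * ε / 2 ≤ 1 := by
    have : c₀ * ε ≤ 1 := mul_le_one₀ hc₀1 hε.le (by linarith)
    linarith
  obtain ⟨c, hc, hc'⟩ := h₂ k hk (c₀ * ε / 2) (by positivity) hδ1
  have hE1 := hc' ν hν (c / 2) (half_pos hc)
  -- `(2 c₀ log N)^k ≤ (c/4) N` eventually (`log^k = o(N)`)
  have hE5 : ∀ᶠ N : ℕ in atTop, (2 * c₀ * Real.log N) ^ k ≤ c / 4 * N := by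
    have hlo := (Real.isLittleO_pow_log_id_atTop (n := k)).comp_tendsto
      (tendsto_natCast_atTop_atTop (R := ℝ))
    have hpos : 0 < c / 4 / (2 * c₀) ^ k := by positivity
    filter_upwards [hlo.bound hpos, eventually_ge_atTop 1] with N hN hN1
    have hN' : Real.log N ^ k ≤ c / 4 / (2 * c₀) ^ k * N := by
      have hl0 : 0 ≤ Real.log N := Real.log_nonneg (by exact_mod_cast hN1)
      have h := hN
      simp only [Function.comp_def, id_eq, norm_pow, Real.norm_eq_abs, abs_of_nonneg hl0,
        Nat.abs_cast] at h
      exact h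
    have h2c : (0 : ℝ) < (2 * c₀) ^ k := by positivity
    calc (2 * c₀ * Real.log N) ^ k = (2 * c₀) ^ k * Real.log N ^ k := mul_pow _ _ _
      _ ≤ (2 * c₀) ^ k * (c / 4 / (2 * c₀) ^ k * N) := by gcongr
      _ = c / 4 * N := by field_simp
  -- fix a large prime `N`
  obtain ⟨N₀, hN₀⟩ := Filter.eventually_atTop.1
    (hE1.and (hmaj.and (hE3.and (hE5.and (eventually_ge_atTop 3)))))
  obtain ⟨N, hN₀N, hNp⟩ := Nat.exists_infinite_primes N₀
  obtain ⟨hE1N, hmajN, hE3N, hE5N, hN3⟩ := hN₀ N hN₀N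
  haveI : Fact N.Prime := ⟨hNp⟩
  have hN0 : (0 : ℝ) < N := by exact_mod_cast hNp.pos
  have hlog0 : 0 < Real.log N := by linarith [one_lt_log_of_three_le (show (3 : ℝ) ≤ N by exact_mod_cast hN3)]
  -- `W = W(N)` and its size
  set W : ℕ := primorial (w N) with hW_def
  have hW0 : 0 < W := primorial_pos _
  have hWlog : (W : ℝ) ≤ Real.log N := primorial_le_log hN3 (hwlog N)
  have hWN : (W : ℝ) * N + 1 ≤ (N : ℝ) ^ 2 := by
    have h1 : Real.log N ≤ N - 1 := Real.log_le_sub_one_of_pos hN0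
    have h3 : (1 : ℝ) ≤ N := by exact_mod_cast hNp.one_le
    nlinarith
  have hlogWN : Real.log ((W : ℝ) * N + 1) ≤ 2 * Real.log N := by
    have h2 : Real.log ((N : ℝ) ^ 2) = 2 * Real.log N := by
      rw [Real.log_pow]; norm_num
    rw [← h2]
    exact Real.log_le_log (by positivity) hWN
  -- the function `f` of p. 523
  set f : ZMod N → ℝ := fun x =>
    if ⌈ε * N⌉₊ ≤ x.val ∧ x.val ≤ ⌊2 * ε * N⌋₊ then c₀ * modifiedVonMangoldt W x.val else 0
    with hf_def
  have hf0 : ∀ x, 0 ≤ f x := fun x => by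
    simp only [hf_def]
    split_ifs
    · exact mul_nonneg hc₀.le (modifiedVonMangoldt_nonneg _ _)
    · exact le_rfl
  have hfν : ∀ x, f x ≤ ν N x := fun x => by
    simp only [hf_def]
    split_ifs with hx
    · have h1 : ε * N ≤ (x.val : ℝ) := Nat.ceil_le.mp hx.1
      have h2 : (x.val : ℝ) ≤ 2 * ε * N := (Nat.le_floor_iff (by positivity)).mp hx.2
      have := hmajN hNp x.val h1 h2
      rwa [ZMod.natCast_zmod_val] at this
    · exact hν.1 N x
  have hfM : ∀ x, f x ≤ 2 * c₀ * Real.log N := fun x => by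
    simp only [hf_def]
    split_ifs with hx
    · have hxN : (x.val : ℝ) ≤ N := by exact_mod_cast (ZMod.val_lt x).le
      calc c₀ * modifiedVonMangoldt W x.val ≤ c₀ * Real.log (W * x.val + 1) := by
            gcongr; exact modifiedVonMangoldt_le_log _ _
        _ ≤ c₀ * Real.log (W * N + 1) := by gcongr
        _ ≤ c₀ * (2 * Real.log N) := by gcongr
        _ = 2 * c₀ * Real.log N := by ring
    · positivity
  -- `E(f) ≥ δ`
  have hlt : ⌊2 * ε * N⌋₊ < N := by
    rw [Nat.floor_lt (by positivity)]
    calc 2 * ε * N < 1 * N := by gcongr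
      _ = N := one_mul _
  have hsum : ∑ x : ZMod N, f x =
      c₀ * ∑ n ∈ Icc ⌈ε * N⌉₊ ⌊2 * ε * N⌋₊, modifiedVonMangoldt W n := by
    have step1 : ∑ x : ZMod N, f x = ∑ n ∈ range N,
        (if ⌈ε * N⌉₊ ≤ n ∧ n ≤ ⌊2 * ε * N⌋₊ then c₀ * modifiedVonMangoldt W n else 0) := by
      refine Finset.sum_nbij' (fun x : ZMod N => x.val) (fun n : ℕ => (n : ZMod N))
        (fun x _ => mem_range.2 (ZMod.val_lt x)) (fun _ _ => mem_univ _)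
        (fun x _ => ZMod.natCast_zmod_val x) (fun n hn => ZMod.val_cast_of_lt (mem_range.1 hn))
        fun x _ => rfl
    rw [step1, ← Finset.sum_filter, ← Finset.mul_sum]
    congr 1
    refine Finset.sum_congr ?_ fun _ _ => rfl
    ext n
    simp only [mem_filter, mem_range, mem_Icc]
    omega
  have hEf : c₀ * ε / 2 ≤ 𝔼 x, f x := by
    rw [Fintype.expect_eq_sum_div_card, ZMod.card, hsum]
    calc c₀ * ε / 2 = c₀ * (ε / 2) := by ring
      _ ≤ c₀ * ((N : ℝ)⁻¹ * ∑ n ∈ Icc ⌈ε * N⌉₊ ⌊2 * ε * N⌋₊, modifiedVonMangoldt W n) := by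
          gcongr
      _ = c₀ * (∑ n ∈ Icc ⌈ε * N⌉₊ ⌊2 * ε * N⌋₊, modifiedVonMangoldt W n) / N := by
          rw [inv_mul_eq_div, mul_div_assoc]
  -- Theorem 3.5
  have hmain : c - c / 2 ≤ 𝔼 x : ZMod N, 𝔼 r : ZMod N, ∏ i : Fin k, f (x + (i : ℕ) * r) :=
    hE1N f hf0 hfν hEf
  -- discard `r = 0`: some `x` and `r ≠ 0` have a nonvanishing product
  have hex : ∃ x r : ZMod N, r ≠ 0 ∧ ∏ i : Fin k, f (x + (i : ℕ) * r) ≠ 0 := by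
    by_contra hcon
    push Not at hcon
    have hr0 : ∀ x : ZMod N,
        𝔼 r : ZMod N, ∏ i : Fin k, f (x + (i : ℕ) * r) = f x ^ k / N := by
      intro x
      rw [Fintype.expect_eq_sum_div_card, ZMod.card, Finset.sum_eq_single (0 : ZMod N)]
      · simp
      · intro r _ hr
        exact hcon x r hr
      · intro h
        exact absurd (Finset.mem_univ _) h
    have hbound : 𝔼 x : ZMod N, 𝔼 r : ZMod N, ∏ i : Fin k, f (x + (i : ℕ) * r) ≤
        (2 * c₀ * Real.log N) ^ k / N := by
      rw [Fintype.expect_eq_sum_div_card, ZMod.card]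
      have h1 : ∑ x : ZMod N, 𝔼 r : ZMod N, ∏ i : Fin k, f (x + (i : ℕ) * r) ≤
          ∑ _x : ZMod N, (2 * c₀ * Real.log N) ^ k / N := by
        refine Finset.sum_le_sum fun x _ => ?_
        rw [hr0 x]
        gcongr
        · exact hf0 x
        · exact hfM x
      rw [Finset.sum_const, Finset.card_univ, ZMod.card, nsmul_eq_mul] at h1
      calc (∑ x : ZMod N, 𝔼 r : ZMod N, ∏ i : Fin k, f (x + (i : ℕ) * r)) / N
          ≤ (N * ((2 * c₀ * Real.log N) ^ k / N)) / N := by gcongr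
        _ = (2 * c₀ * Real.log N) ^ k / N := by field_simp
    have h2 : (2 * c₀ * Real.log N) ^ k / N ≤ c / 4 := by
      rw [div_le_iff₀ hN0]
      exact hE5N
    linarith
  obtain ⟨x, r, hr, hprod⟩ := hex
  have hfi : ∀ i : Fin k, f (x + (i : ℕ) * r) ≠ 0 := fun i =>
    (Finset.prod_ne_zero_iff.mp hprod) i (Finset.mem_univ _)
  -- the representatives `n_i ∈ [ε N, 2 ε N]` with `W n_i + 1` prime
  set n : Fin k → ℕ := fun i => (x + (i : ℕ) * r).val with hn_def
  have hwin : ∀ i, ⌈ε * N⌉₊ ≤ n i ∧ n i ≤ ⌊2 * ε * N⌋₊ := fun i => by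
    by_contra hc
    exact hfi i (by simp only [hf_def]; rw [if_neg hc])
  have hprime : ∀ i, (W * n i + 1).Prime := fun i => by
    have h := hfi i
    simp only [hf_def] at h
    rw [if_pos (hwin i)] at h
    exact prime_of_modifiedVonMangoldt_ne_zero (right_ne_zero_of_mul h)
  have hcong : ∀ i, ((n i : ℕ) : ZMod N) = x + (i : ℕ) * r := fun i => ZMod.natCast_zmod_val _
  -- window length `B ≤ ε N`, and `k B ≤ k ε N ≤ N/2 < N`
  set B : ℕ := ⌊2 * ε * N⌋₊ - ⌈ε * N⌉₊ with hB_def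
  have hkB : k * B < N := by
    have hB : (B : ℝ) ≤ ε * N := by
      have h1 : (⌊2 * ε * N⌋₊ : ℝ) ≤ 2 * ε * N := Nat.floor_le (by positivity)
      have h2 : ε * N ≤ (⌈ε * N⌉₊ : ℝ) := Nat.le_ceil _
      rcases le_or_gt ⌈ε * N⌉₊ ⌊2 * ε * N⌋₊ with h | h
      · have : (B : ℝ) = ⌊2 * ε * N⌋₊ - ⌈ε * N⌉₊ := by
          rw [hB_def, Nat.cast_sub h]
        linarith
      · have : B = 0 := by rw [hB_def]; omega
        rw [this, Nat.cast_zero]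
        positivity
    have : (k : ℝ) * B < N := by
      calc (k : ℝ) * B ≤ k * (ε * N) := by gcongr
        _ = (2 * k * ε) * N / 2 := by ring
        _ ≤ 1 * N / 2 := by gcongr
        _ < N := by linarith
    exact_mod_cast this
  obtain ⟨d, hd, hnd⟩ := exists_int_common_difference (by omega : 2 ≤ k) hkB x r hr n ⌈ε * N⌉₊
    hcong (fun i => (hwin i).1) (fun i => by have := (hwin i).2; rw [hB_def]; omega)
  exact exists_prime_ap_of_window n d hd ⟨0, by omega⟩ hnd hW0 hprime

end Literature.NumberTheory.Sieve
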